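import Literature.AlgebraicGeometry.AbelianSchemes.AbelianSchemeIdempotentImage
import Literature.AlgebraicGeometry.AbelianSchemes.AbelianSchemeOverRingAction
import HarnessLib

/-!
# Serre's tensor construction `A ⊗_𝒪 𝔟`: the abelian scheme `Fix([E] ↷ Aⁿ)` attached to an abelian scheme `A/S` with an
# `𝒪`-action and a finitely generated projective `𝒪`-module `𝔟 = E·𝒪ⁿ` (`E² = E ∈ Mₙ(𝒪)`); its points and its `𝒪`-action

Topic `AlgebraicGeometry/AbelianSchemes`, namespace `Literature.AlgebraicGeometry.AbelianSchemes.AbelianSchemeOver` (constructions with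
bodies + proved theorems; no named fact, no `sorry`, no `instance` declaration, no notation; ANY base scheme `S`).  Cell `hodgecm-mathlib`,
programme F0/P6 «MOD» (sub-desk P6a, generic organ (g2) «Serre tensor construction», FILE 2; FILE 1 = ★ `AbelianSchemeIdempotentImage`
(`prod`, `pow`, `fixed`), FILE 1b = ★ `AbelianSchemeOverRingAction` (the carrier `RingAction O A`); `--supports stmt-HodgeConjecture-24832`,
count-neutral).  HC_CM is proved only modulo the 2 remaining named inputs (hLiu418, h413) until rung 0 closes; this file discharges none of
them.

## Mathematics (B. Conrad, *Gross–Zagier revisited* §7; Z. Amir-Khosravi, *Serre's tensor construction and moduli of abelian schemes*)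

Let `A → S` be an abelian scheme with commutative group law (`[IsCommMonObj A.X]`) and `ι : 𝒪 → End_S(A)` a ring action (★ `RingAction`).
A matrix `M ∈ Mₙ(𝒪)` acts on `Aⁿ` by the homomorphism `[M] : Aⁿ → Aⁿ`, `(x_k)_k ↦ (∑_k M_{jk} x_k)_j` — written multiplicatively in the group
`A(T)` of `T`-points: `∏_k x_k ≫ ι(M_{jk})` — with `[1] = 𝟙`, `[MN] = [N] ≫ [M]`, `[M + N] = [M]·[N]`, `[0] = 1`.  For a finitely generated
PROJECTIVE `𝒪`-module presented as `𝔟 = E·𝒪ⁿ` with `E² = E`, SERRE'S TENSOR CONSTRUCTION is the abelian scheme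
`A ⊗_𝒪 𝔟 := Fix([E]) = [E](Aⁿ) ⊆ Aⁿ` (★ `fixed`, FILE 1: a direct factor of `Aⁿ`, again an abelian scheme over `S`); its `T`-points are
`{x ∈ A(T)ⁿ | E·x = x} = A(T) ⊗_𝒪 𝔟`, functorially in `T`, and `𝒪` acts on it through the central scalars `[a·1]` (which commute with `[E]`).
The identification of `{x | E x = x}` with the abstract tensor product `A(T) ⊗_𝒪 𝔟`, independence of the presentation `(n, E)`, base change
and the behaviour of polarisations are NOT in this file (FILE 3).

## Contents

* §1 points of products and powers: `prodFst∕prodSnd∕prodLift` (+ `_fst∕_snd`, `prod_hom_ext`, homs), the identity iso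
  `powSuccIso : (A.pow (n+1)).X ≅ ((A.pow n).prod A).X` (inserted so that composites are typed on the nose), `powProj n k : (A.pow n).X ⟶ A.X`,
  `powLift`, **`powHomEquiv A n T : (T ⟶ (A.pow n).X) ≃ (Fin n → (T ⟶ A.X))`** (`_mul`, `_comp`), `isMonHom_powProj∕_powLift`;
* §2 `matrixComp act M x` (the coordinates of `M·x`; `_one∕_mul∕_add∕_zero∕_comp∕_mul_pts`), **`matrixEnd act M : (A.pow n).X ⟶ (A.pow n).X`**
  (`powHomEquiv_comp_matrixEnd`, `isMonHom_matrixEnd`, **`matrixEnd_one∕_mul∕_add∕_zero∕_idem`**, `matrixEnd_scalar_comm`);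
* §3 for an idempotent `e` and `g` commuting with it: `fixedMap e he g : fixedOver e ⟶ fixedOver e` (`fixedMap_ι : _ ≫ ι = ι ≫ g`,
  `isMonHom_fixedMap`, `_id∕_comp∕_mul∕_one`);
* §4 **`serreTensor act E hE : AbelianSchemeOver S`** (`hE : E * E = E`), `serreι∕serreπ` (homs; `π ≫ ι = [E]`, `ι ≫ π = 𝟙`; `ι` mono),
  **`serreHomEquiv act E hE T : (T ⟶ (serreTensor act E hE).X) ≃ {x : Fin n → (T ⟶ A.X) // matrixComp act E x = x}`** (`_apply_coe`,
  `_symm_apply`, `_mul`, `_comp`), `isCommMonObj_serreTensor`, **`serreAction act E hE : (serreTensor act E hE).RingAction O`** and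
  `serreAction_i_comp_ι : (a·) ≫ ι = ι ≫ [a·1]`.

## References
* [Conrad2004GrossZagier] B. Conrad, *Gross–Zagier revisited*, in: Heegner points and Rankin L-series, MSRI Publ. 49 (2004), §7 (Serre's
  construction `M ⊗_R A`).
* [AmirKhosravi2018SerreTensor] Z. Amir-Khosravi, *Serre's tensor construction and moduli of abelian schemes*, Manuscripta Math. 156 (2018).
* [Kottwitz1992] R. E. Kottwitz, *Points on some Shimura varieties over finite fields*, JAMS 5 (1992), §5 (p. 390): `i : O_B → End(A)`.
* [MumfordFogartyKirwan1994] GIT, Ch. 6 §1 Def. 6.1, Cor. 6.4–6.5 (group schemes, products, homomorphisms).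
* [GortzWedhorn2020] Algebraic Geometry I, Def. 9.1 (3) ∕ Prop. 9.3 (equalizers and their points); [GortzWedhorn2023] II, Def. 27.89 ∕
  Prop. 27.92 (abelian schemes).
* Tree: ★ `AbelianSchemes/AbelianSchemeIdempotentImage` (FILE 1), ★ `AbelianSchemes/AbelianSchemeOverRingAction` (FILE 1b).
-/

noncomputable section

universe u

open CategoryTheory CategoryTheory.Limits AlgebraicGeometry MonoidalCategory CartesianMonoidalCategory
open scoped MonObj

namespace Literature.AlgebraicGeometry.AbelianSchemes

namespace AbelianSchemeOver

variable {S : Scheme.{u}} (A : AbelianSchemeOver S)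

/-! ## §1 Points of products and powers: `(T ⟶ A × B) ≃ (T ⟶ A) × (T ⟶ B)`, `(T ⟶ Aⁿ) ≃ (Fin n → (T ⟶ A))` -/

section ProdPoints

variable (B : AbelianSchemeOver S)

/-- First projection `A ×_S B ⟶ A` (Mathlib `fst`, typed on the carrier `(A.prod B).X`).
[cite: MumfordFogartyKirwan1994, Ch. 6 §1 Definition 6.1 (p. 115)] -/
def prodFst : (A.prod B).X ⟶ A.X := fst A.X B.X

/-- Second projection `A ×_S B ⟶ B`. [cite: MumfordFogartyKirwan1994, Ch. 6 §1 Definition 6.1 (p. 115)] -/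
def prodSnd : (A.prod B).X ⟶ B.X := snd A.X B.X

variable {A B}

/-- Pairing `(f, g) : T ⟶ A ×_S B`. [cite: MumfordFogartyKirwan1994, Ch. 6 §1 Definition 6.1 (p. 115)] -/
def prodLift {T : Over S} (f : T ⟶ A.X) (g : T ⟶ B.X) : T ⟶ (A.prod B).X := lift f g

/-- `(f, g) ≫ pr₁ = f`. [cite: MumfordFogartyKirwan1994, Ch. 6 §1 Definition 6.1 (p. 115)] -/
@[reassoc (attr := simp)]
theorem prodLift_fst {T : Over S} (f : T ⟶ A.X) (g : T ⟶ B.X) : prodLift f g ≫ A.prodFst B = f := lift_fst f g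

/-- `(f, g) ≫ pr₂ = g`. [cite: MumfordFogartyKirwan1994, Ch. 6 §1 Definition 6.1 (p. 115)] -/
@[reassoc (attr := simp)]
theorem prodLift_snd {T : Over S} (f : T ⟶ A.X) (g : T ⟶ B.X) : prodLift f g ≫ A.prodSnd B = g := lift_snd f g

/-- Points of `A ×_S B` are determined by their two projections. [cite: MumfordFogartyKirwan1994, Ch. 6 §1 Definition 6.1 (p. 115)] -/
theorem prod_hom_ext {T : Over S} {g h : T ⟶ (A.prod B).X} (h₁ : g ≫ A.prodFst B = h ≫ A.prodFst B)
    (h₂ : g ≫ A.prodSnd B = h ≫ A.prodSnd B) : g = h :=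
  CartesianMonoidalCategory.hom_ext g h h₁ h₂

variable (A B) in
/-- The projections are homomorphisms. [cite: MumfordFogartyKirwan1994, Ch. 6 §1 Corollary 6.4 (p. 117)] -/
theorem isMonHom_prodFst_prodSnd : IsMonHom (A.prodFst B) ∧ IsMonHom (A.prodSnd B) :=
  ⟨inferInstanceAs (IsMonHom (fst A.X B.X)), inferInstanceAs (IsMonHom (snd A.X B.X))⟩

/-- A pair of homomorphisms is a homomorphism. [cite: MumfordFogartyKirwan1994, Ch. 6 §1 Corollary 6.4 (p. 117)] -/
theorem isMonHom_prodLift {T : Over S} [GrpObj T] (f : T ⟶ A.X) (g : T ⟶ B.X) [IsMonHom f] [IsMonHom g] :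
    IsMonHom (prodLift f g) :=
  inferInstanceAs (IsMonHom (lift f g))

end ProdPoints

section PowPoints

/-- The identification `Aⁿ⁺¹ = Aⁿ ×_S A` as an explicit (identity) isomorphism of carriers — inserted so that every composite
below is typed on the nose (`A.pow (n+1)` unfolds to `(A.pow n).prod A` only definitionally).
[cite: MumfordFogartyKirwan1994, Ch. 6 §1 Definition 6.1 (p. 115)] -/
def powSuccIso (n : ℕ) : (A.pow (n + 1)).X ≅ ((A.pow n).prod A).X := Iso.refl _

/-- Both directions of `powSuccIso` are homomorphisms (they are identities). [cite: MumfordFogartyKirwan1994, Ch. 6 §1 Definition 6.1 (p. 115)] -/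
theorem isMonHom_powSuccIso (n : ℕ) : IsMonHom (A.powSuccIso n).hom ∧ IsMonHom (A.powSuccIso n).inv :=
  ⟨inferInstanceAs (IsMonHom (𝟙 ((A.pow n).prod A).X)), inferInstanceAs (IsMonHom (𝟙 ((A.pow n).prod A).X))⟩

/-- The coordinate projections `pr_k : Aⁿ ⟶ A` (`Aⁿ⁺¹ = Aⁿ ×_S A`: the last coordinate is `pr₂`, the others factor through `pr₁`).
[cite: MumfordFogartyKirwan1994, Ch. 6 §1 Definition 6.1 (p. 115)] -/
def powProj : (n : ℕ) → Fin n → ((A.pow n).X ⟶ A.X)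
  | 0, k => k.elim0
  | n + 1, k => (A.powSuccIso n).hom ≫
      Fin.lastCases ((A.pow n).prodSnd A) (fun j => (A.pow n).prodFst A ≫ powProj n j) k

/-- `pr_{last} = pr₂`. [cite: MumfordFogartyKirwan1994, Ch. 6 §1 Definition 6.1 (p. 115)] -/
@[simp] theorem powProj_last (n : ℕ) : A.powProj (n + 1) (Fin.last n) = (A.powSuccIso n).hom ≫ (A.pow n).prodSnd A := by
  simp only [powProj, Fin.lastCases_last]

/-- `pr_{castSucc j} = pr₁ ≫ pr_j`. [cite: MumfordFogartyKirwan1994, Ch. 6 §1 Definition 6.1 (p. 115)] -/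
@[simp] theorem powProj_castSucc (n : ℕ) (j : Fin n) :
    A.powProj (n + 1) (Fin.castSucc j) = (A.powSuccIso n).hom ≫ (A.pow n).prodFst A ≫ A.powProj n j := by
  simp only [powProj, Fin.lastCases_castSucc]

/-- Each projection `pr_k : Aⁿ ⟶ A` is a homomorphism. [cite: MumfordFogartyKirwan1994, Ch. 6 §1 Corollary 6.4 (p. 117)] -/
theorem isMonHom_powProj : ∀ (n : ℕ) (k : Fin n), IsMonHom (A.powProj n k)
  | 0, k => k.elim0
  | n + 1, k => by
    haveI := (A.isMonHom_powSuccIso n).1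
    haveI := (isMonHom_prodFst_prodSnd (A.pow n) A).1
    haveI := (isMonHom_prodFst_prodSnd (A.pow n) A).2
    induction k using Fin.lastCases with
    | last => rw [powProj_last]; infer_instance
    | cast j =>
      rw [powProj_castSucc]
      haveI := isMonHom_powProj n j
      infer_instance

variable {A}

/-- Tupling: the `T`-point `(f_k)_k` of `Aⁿ`. [cite: MumfordFogartyKirwan1994, Ch. 6 §1 Definition 6.1 (p. 115)] -/
def powLift : {n : ℕ} → {T : Over S} → (Fin n → (T ⟶ A.X)) → (T ⟶ (A.pow n).X)
  | 0, _, _ => toUnit _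
  | n + 1, _, f => prodLift (powLift fun j => f (Fin.castSucc j)) (f (Fin.last _)) ≫ (A.powSuccIso n).inv

/-- `(f_k)_k ≫ pr_k = f_k`. [cite: MumfordFogartyKirwan1994, Ch. 6 §1 Definition 6.1 (p. 115)] -/
@[simp]
theorem powLift_powProj : ∀ {n : ℕ} {T : Over S} (f : Fin n → (T ⟶ A.X)) (k : Fin n),
    powLift f ≫ A.powProj n k = f k
  | 0, _, _, k => k.elim0
  | n + 1, T, f, k => by
    induction k using Fin.lastCases with
    | last => rw [powProj_last, powLift, Category.assoc, Iso.inv_hom_id_assoc, prodLift_snd]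
    | cast j =>
      rw [powProj_castSucc, powLift, Category.assoc, Iso.inv_hom_id_assoc, prodLift_fst_assoc, powLift_powProj]

/-- Two `T`-points of `Aⁿ` with the same coordinates are equal. [cite: MumfordFogartyKirwan1994, Ch. 6 §1 Definition 6.1 (p. 115)] -/
theorem pow_hom_ext : ∀ {n : ℕ} {T : Over S} {g h : T ⟶ (A.pow n).X},
    (∀ k, g ≫ A.powProj n k = h ≫ A.powProj n k) → g = h
  | 0, _, g, h, _ => toUnit_unique g h
  | n + 1, T, g, h, hk => by
    rw [← cancel_mono (A.powSuccIso n).hom]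
    apply prod_hom_ext
    · exact pow_hom_ext fun j => by
        have := hk (Fin.castSucc j)
        simpa only [powProj_castSucc, Category.assoc] using this
    · have := hk (Fin.last n)
      simpa only [powProj_last, Category.assoc] using this

/-- `g = (g ≫ pr_k)_k`. [cite: MumfordFogartyKirwan1994, Ch. 6 §1 Definition 6.1 (p. 115)] -/
theorem powLift_comp_powProj {n : ℕ} {T : Over S} (g : T ⟶ (A.pow n).X) :
    powLift (fun k => g ≫ A.powProj n k) = g :=
  pow_hom_ext fun k => by rw [powLift_powProj]

variable (A) in
/-- **`(T ⟶ Aⁿ) ≃ (Fin n → (T ⟶ A))`**: the `T`-points of `Aⁿ` are `n`-tuples of `T`-points of `A`.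
[cite: MumfordFogartyKirwan1994, Ch. 6 §1 Definition 6.1 (p. 115)] -/
def powHomEquiv (n : ℕ) (T : Over S) : (T ⟶ (A.pow n).X) ≃ (Fin n → (T ⟶ A.X)) where
  toFun g k := g ≫ A.powProj n k
  invFun := powLift
  left_inv g := powLift_comp_powProj g
  right_inv f := funext fun k => powLift_powProj f k

/-- `powHomEquiv g k = g ≫ pr_k`. [cite: MumfordFogartyKirwan1994, Ch. 6 §1 Definition 6.1 (p. 115)] -/
@[simp] theorem powHomEquiv_apply {n : ℕ} {T : Over S} (g : T ⟶ (A.pow n).X) (k : Fin n) :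
    powHomEquiv A n T g k = g ≫ A.powProj n k := rfl

/-- `powHomEquiv⁻¹ = powLift`. [cite: MumfordFogartyKirwan1994, Ch. 6 §1 Definition 6.1 (p. 115)] -/
@[simp] theorem powHomEquiv_symm_apply {n : ℕ} {T : Over S} (f : Fin n → (T ⟶ A.X)) :
    (powHomEquiv A n T).symm f = powLift f := rfl

/-- `powHomEquiv` is multiplicative (coordinatewise group law). [cite: MumfordFogartyKirwan1994, Ch. 6 §1 Corollary 6.4 (p. 117)] -/
theorem powHomEquiv_mul {n : ℕ} {T : Over S} (g h : T ⟶ (A.pow n).X) :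
    powHomEquiv A n T (g * h) = powHomEquiv A n T g * powHomEquiv A n T h := by
  funext k
  haveI := A.isMonHom_powProj n k
  simp only [powHomEquiv_apply, Pi.mul_apply, MonObj.mul_comp]

/-- Precomposition is compatible with coordinates: `(t ≫ g) ≫ pr_k = t ≫ (g ≫ pr_k)`.
[cite: MumfordFogartyKirwan1994, Ch. 6 §1 Definition 6.1 (p. 115)] -/
theorem powHomEquiv_comp {n : ℕ} {T T' : Over S} (t : T' ⟶ T) (g : T ⟶ (A.pow n).X) (k : Fin n) :
    powHomEquiv A n T' (t ≫ g) k = t ≫ powHomEquiv A n T g k := by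
  simp only [powHomEquiv_apply, Category.assoc]

/-- A tuple of homomorphisms is a homomorphism `T ⟶ Aⁿ`. [cite: MumfordFogartyKirwan1994, Ch. 6 §1 Corollary 6.4 (p. 117)] -/
theorem isMonHom_powLift : ∀ {n : ℕ} {T : Over S} [GrpObj T] (f : Fin n → (T ⟶ A.X)),
    (∀ k, IsMonHom (f k)) → IsMonHom (powLift f)
  | 0, T, _, _, _ => by
    rw [powLift]
    exact inferInstanceAs (IsMonHom (toUnit T))
  | n + 1, T, _, f, hf => by
    rw [powLift]
    haveI := isMonHom_powLift (fun j => f (Fin.castSucc j)) (fun j => hf _)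
    haveI := hf (Fin.last n)
    haveI := isMonHom_prodLift (powLift fun j => f (Fin.castSucc j)) (f (Fin.last n))
    haveI := (A.isMonHom_powSuccIso n).2
    infer_instance

end PowPoints

/-! ## §2 Products in the group of points; the endomorphism of `Aⁿ` attached to a matrix `M ∈ Mₙ(𝒪)` -/

section Matrix

variable {A} {O : Type*} [CommRing O] (act : A.RingAction O)

/-- Precomposition distributes over finite products in the group of points (of a commutative group object).
[cite: MumfordFogartyKirwan1994, Ch. 6 §1 Corollary 6.4 (p. 117)] -/
theorem comp_finset_prod {T T' : Over S} {X : Over S} [GrpObj X] [IsCommMonObj X] (t : T' ⟶ T) {κ : Type*} (s : Finset κ)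
    (g : κ → (T ⟶ X)) : t ≫ (∏ k ∈ s, g k) = ∏ k ∈ s, (t ≫ g k) := by
  classical
  induction s using Finset.induction_on with
  | empty => rw [Finset.prod_empty, Finset.prod_empty, MonObj.comp_one]
  | insert a s ha ih => rw [Finset.prod_insert ha, Finset.prod_insert ha, MonObj.comp_mul, ih]

/-- Postcomposition with a homomorphism distributes over finite products in the group of points.
[cite: MumfordFogartyKirwan1994, Ch. 6 §1 Corollary 6.4 (p. 117)] -/
theorem finset_prod_comp {T : Over S} {X Y : Over S} [GrpObj X] [IsCommMonObj X] [GrpObj Y] [IsCommMonObj Y]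
    (φ : X ⟶ Y) [IsMonHom φ] {κ : Type*}
    (s : Finset κ) (g : κ → (T ⟶ X)) : (∏ k ∈ s, g k) ≫ φ = ∏ k ∈ s, (g k ≫ φ) :=
  map_prod (IsMonHom.monoidHom φ T) g s

/-- A finite product of homomorphisms into a COMMUTATIVE group object is a homomorphism.
[cite: MumfordFogartyKirwan1994, Ch. 6 §1 Corollary 6.4 (p. 117)] -/
theorem isMonHom_finset_prod {X Y : Over S} [GrpObj X] [GrpObj Y] [IsCommMonObj Y] {κ : Type*} (s : Finset κ)
    (g : κ → (X ⟶ Y)) (hg : ∀ k ∈ s, IsMonHom (g k)) : IsMonHom (∏ k ∈ s, g k) := by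
  classical
  induction s using Finset.induction_on with
  | empty => rw [Finset.prod_empty, Hom.one_def]; infer_instance
  | insert a s ha ih =>
    rw [Finset.prod_insert ha, Hom.mul_def]
    haveI := hg a (Finset.mem_insert_self a s)
    haveI := ih fun k hk => hg k (Finset.mem_insert_of_mem hk)
    infer_instance

variable [IsCommMonObj A.X]

/-- `ι (∑_l a_l) = ∏_l ι (a_l)` (additivity of the action, iterated). [cite: Kottwitz1992, §5 (p. 390)] -/
theorem i_finset_sum {κ : Type*} (s : Finset κ) (a : κ → O) : act.i (∑ l ∈ s, a l) = ∏ l ∈ s, act.i (a l) := by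
  classical
  induction s using Finset.induction_on with
  | empty => rw [Finset.sum_empty, Finset.prod_empty, act.i_zero]
  | insert b s hb ih => rw [Finset.sum_insert hb, Finset.prod_insert hb, act.i_add, ih]

variable {n : ℕ}

/-- The `j`-th coordinate of `M · x` for a tuple of points `x = (x_k)_k`: `∏_k x_k ≫ ι(M j k)` (= «`∑_k M_{jk} x_k`» in the
additive group of points). [cite: Kottwitz1992, §5 (p. 390)] -/
def matrixComp (M : Matrix (Fin n) (Fin n) O) {T : Over S} (x : Fin n → (T ⟶ A.X)) (j : Fin n) : T ⟶ A.X :=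
  ∏ k : Fin n, x k ≫ act.i (M j k)

/-- `1 · x = x`. [cite: Kottwitz1992, §5 (p. 390)] -/
theorem matrixComp_one {T : Over S} (x : Fin n → (T ⟶ A.X)) : matrixComp act 1 x = x := by
  funext j
  unfold matrixComp
  rw [Finset.prod_eq_single j (fun k _ hkj => by rw [Matrix.one_apply_ne' hkj, act.i_zero, MonObj.comp_one])
    (fun h => absurd (Finset.mem_univ j) h), Matrix.one_apply_eq, act.i_one, Category.comp_id]

/-- `(M N) · x = M · (N · x)`. [cite: Kottwitz1992, §5 (p. 390)] -/
theorem matrixComp_mul (M N : Matrix (Fin n) (Fin n) O) {T : Over S} (x : Fin n → (T ⟶ A.X)) :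
    matrixComp act (M * N) x = matrixComp act M (matrixComp act N x) := by
  funext j
  unfold matrixComp
  simp only [Matrix.mul_apply, i_finset_sum, comp_finset_prod]
  haveI : ∀ a, IsMonHom (act.i a) := act.isMonHom
  simp only [finset_prod_comp, Category.assoc, ← act.i_mul]
  rw [Finset.prod_comm]

/-- `(M + N) · x = (M · x) * (N · x)`. [cite: Kottwitz1992, §5 (p. 390)] -/
theorem matrixComp_add (M N : Matrix (Fin n) (Fin n) O) {T : Over S} (x : Fin n → (T ⟶ A.X)) :
    matrixComp act (M + N) x = matrixComp act M x * matrixComp act N x := by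
  funext j
  unfold matrixComp
  simp only [Matrix.add_apply, act.i_add, MonObj.comp_mul, Pi.mul_apply, Finset.prod_mul_distrib]

/-- `0 · x = 1` (the unit of the group of points). [cite: Kottwitz1992, §5 (p. 390)] -/
theorem matrixComp_zero {T : Over S} (x : Fin n → (T ⟶ A.X)) : matrixComp act (0 : Matrix (Fin n) (Fin n) O) x = 1 := by
  funext j
  unfold matrixComp
  simp only [Matrix.zero_apply, act.i_zero, MonObj.comp_one, Finset.prod_const_one, Pi.one_apply]

/-- `M · (t ≫ x) = t ≫ (M · x)` (naturality in `T`). [cite: Kottwitz1992, §5 (p. 390)] -/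
theorem matrixComp_comp (M : Matrix (Fin n) (Fin n) O) {T T' : Over S} (t : T' ⟶ T) (x : Fin n → (T ⟶ A.X)) :
    matrixComp act M (fun k => t ≫ x k) = fun j => t ≫ matrixComp act M x j := by
  funext j
  unfold matrixComp
  rw [comp_finset_prod]
  exact Finset.prod_congr rfl fun k _ => Category.assoc t (x k) (act.i (M j k))

/-- `M · (x * y) = (M · x) * (M · y)` (commutative `A`). [cite: Kottwitz1992, §5 (p. 390)] -/
theorem matrixComp_mul_pts (M : Matrix (Fin n) (Fin n) O) {T : Over S} (x y : Fin n → (T ⟶ A.X)) :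
    matrixComp act M (x * y) = matrixComp act M x * matrixComp act M y := by
  funext j
  unfold matrixComp
  haveI : ∀ a, IsMonHom (act.i a) := act.isMonHom
  simp only [Pi.mul_apply, MonObj.mul_comp, Finset.prod_mul_distrib]

/-- **The endomorphism `[M] : Aⁿ ⟶ Aⁿ` of the matrix `M ∈ Mₙ(𝒪)`**: `(x_k)_k ↦ (∏_k x_k ≫ ι(M j k))_j`, defined on the
universal point (Yoneda). [cite: Kottwitz1992, §5 (p. 390)] -/
def matrixEnd (M : Matrix (Fin n) (Fin n) O) : (A.pow n).X ⟶ (A.pow n).X :=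
  powLift (matrixComp act M fun k => A.powProj n k)

/-- On points, `[M]` is `x ↦ M · x`. [cite: Kottwitz1992, §5 (p. 390)] -/
theorem powHomEquiv_comp_matrixEnd (M : Matrix (Fin n) (Fin n) O) {T : Over S} (g : T ⟶ (A.pow n).X) :
    powHomEquiv A n T (g ≫ matrixEnd act M) = matrixComp act M (powHomEquiv A n T g) := by
  funext j
  rw [powHomEquiv_apply, matrixEnd, Category.assoc, powLift_powProj]
  exact (congrFun (matrixComp_comp act M g fun k => A.powProj n k) j).symm

/-- `[M]` is a homomorphism of `S`-group schemes (commutative `A`). [cite: Kottwitz1992, §5 (p. 390)] -/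
theorem isMonHom_matrixEnd (M : Matrix (Fin n) (Fin n) O) : IsMonHom (matrixEnd act M) := by
  unfold matrixEnd matrixComp
  refine isMonHom_powLift _ fun j => isMonHom_finset_prod _ _ fun k _ => ?_
  haveI := A.isMonHom_powProj n k
  haveI := act.isMonHom (M j k)
  infer_instance

/-- On the universal point: the coordinates of `[M]` are `M · (pr_k)_k`. [cite: Kottwitz1992, §5 (p. 390)] -/
theorem powHomEquiv_matrixEnd (M : Matrix (Fin n) (Fin n) O) :
    powHomEquiv A n _ (matrixEnd act M) = matrixComp act M (fun k => A.powProj n k) :=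
  (powHomEquiv A n _).apply_symm_apply _

/-- `[1] = 𝟙`. [cite: Kottwitz1992, §5 (p. 390)] -/
theorem matrixEnd_one : matrixEnd act (1 : Matrix (Fin n) (Fin n) O) = 𝟙 (A.pow n).X := by
  apply (powHomEquiv A n _).injective
  rw [powHomEquiv_matrixEnd, matrixComp_one]
  funext k
  rw [powHomEquiv_apply, Category.id_comp]

/-- `[M N] = [N] ≫ [M]`. [cite: Kottwitz1992, §5 (p. 390)] -/
theorem matrixEnd_mul (M N : Matrix (Fin n) (Fin n) O) :
    matrixEnd act (M * N) = matrixEnd act N ≫ matrixEnd act M := by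
  apply (powHomEquiv A n _).injective
  rw [powHomEquiv_matrixEnd, matrixComp_mul, powHomEquiv_comp_matrixEnd, powHomEquiv_matrixEnd]

/-- `[M + N] = [M] * [N]` in `End_S(Aⁿ)`. [cite: Kottwitz1992, §5 (p. 390)] -/
theorem matrixEnd_add (M N : Matrix (Fin n) (Fin n) O) :
    matrixEnd act (M + N) = matrixEnd act M * matrixEnd act N := by
  apply (powHomEquiv A n _).injective
  rw [powHomEquiv_matrixEnd, matrixComp_add, powHomEquiv_mul, powHomEquiv_matrixEnd, powHomEquiv_matrixEnd]

/-- `[0] = 1` (the unit endomorphism). [cite: Kottwitz1992, §5 (p. 390)] -/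
theorem matrixEnd_zero : matrixEnd act (0 : Matrix (Fin n) (Fin n) O) = 1 := by
  apply (powHomEquiv A n _).injective
  rw [powHomEquiv_matrixEnd, matrixComp_zero]
  funext k
  haveI := A.isMonHom_powProj n k
  rw [Pi.one_apply, powHomEquiv_apply, MonObj.one_comp]

/-- An idempotent matrix gives an idempotent endomorphism: `E² = E ⇒ [E] ≫ [E] = [E]`. [cite: Kottwitz1992, §5 (p. 390)] -/
theorem matrixEnd_idem {E : Matrix (Fin n) (Fin n) O} (hE : E * E = E) : matrixEnd act E ≫ matrixEnd act E = matrixEnd act E := by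
  rw [← matrixEnd_mul, hE]

end Matrix

/-! ## §3 Endomorphisms commuting with an idempotent restrict to its fixed subgroup scheme -/

section FixedMap

variable {A} {B : AbelianSchemeOver S} (e : B.X ⟶ B.X) [IsMonHom e] (he : e ≫ e = e) (g : B.X ⟶ B.X) (hg : g ≫ e = e ≫ g)

/-- For `g` commuting with the idempotent `e`, the induced endomorphism `g|_{Fix(e)} := ι ≫ g ≫ π` of `Fix(e)`.
[cite: GortzWedhorn2020, Definition 9.1 (3) and Proposition 9.3] -/
def fixedMap : fixedOver e ⟶ fixedOver e := (fixedι e ≫ g) ≫ fixedπ e he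

include hg in
/-- `g|_{Fix(e)} ≫ ι = ι ≫ g`. [cite: GortzWedhorn2020, Definition 9.1 (3) and Proposition 9.3] -/
@[reassoc]
theorem fixedMap_ι : fixedMap e he g ≫ fixedι e = fixedι e ≫ g := by
  rw [fixedMap, Category.assoc, Category.assoc, fixedπ_comp_ι, hg, ← Category.assoc, fixedι_comp]

/-- `g|_{Fix(e)}` is a homomorphism when `g` is. [cite: GortzWedhorn2020, Definition 9.1 (3) and Proposition 9.3] -/
theorem isMonHom_fixedMap [IsMonHom g] : IsMonHom (fixedMap e he g) := by
  haveI := isMonHom_fixedι e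
  haveI := isMonHom_fixedπ e he
  unfold fixedMap
  infer_instance

/-- `𝟙|_{Fix(e)} = 𝟙`. [cite: GortzWedhorn2020, Definition 9.1 (3) and Proposition 9.3] -/
theorem fixedMap_id : fixedMap e he (𝟙 B.X) = 𝟙 _ := by
  rw [fixedMap, Category.comp_id, fixedι_comp_π]

include hg in
/-- `(g ≫ g')|_{Fix(e)} = g|_{Fix(e)} ≫ g'|_{Fix(e)}`. [cite: GortzWedhorn2020, Definition 9.1 (3) and Proposition 9.3] -/
theorem fixedMap_comp (g' : B.X ⟶ B.X) (hg' : g' ≫ e = e ≫ g') :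
    fixedMap e he (g ≫ g') = fixedMap e he g ≫ fixedMap e he g' := by
  haveI := mono_fixedι e
  have hgg' : (g ≫ g') ≫ e = e ≫ (g ≫ g') := by rw [Category.assoc, hg', ← Category.assoc, hg, Category.assoc]
  rw [← cancel_mono (fixedι e), fixedMap_ι e he (g ≫ g') hgg']
  simp only [Category.assoc, fixedMap_ι e he g' hg', fixedMap_ι_assoc e he g hg]

include hg in
/-- `(g * g')|_{Fix(e)} = g|_{Fix(e)} * g'|_{Fix(e)}` (pointwise product of endomorphisms). [cite: GortzWedhorn2020, Definition 9.1 (3) and Proposition 9.3] -/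
theorem fixedMap_mul [IsCommMonObj B.X] (g' : B.X ⟶ B.X) (hg' : g' ≫ e = e ≫ g') :
    fixedMap e he (g * g') = fixedMap e he g * fixedMap e he g' := by
  haveI := mono_fixedι e
  haveI := isMonHom_fixedι e
  have hgg' : (g * g') ≫ e = e ≫ (g * g') := by rw [MonObj.mul_comp, MonObj.comp_mul, hg, hg']
  rw [← cancel_mono (fixedι e), fixedMap_ι e he (g * g') hgg', MonObj.mul_comp, MonObj.comp_mul, fixedMap_ι e he g hg,
    fixedMap_ι e he g' hg']

/-- `1|_{Fix(e)} = 1` (the unit endomorphism). [cite: GortzWedhorn2020, Definition 9.1 (3) and Proposition 9.3] -/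
theorem fixedMap_one : fixedMap e he (1 : B.X ⟶ B.X) = 1 := by
  haveI := mono_fixedι e
  haveI := isMonHom_fixedι e
  rw [← cancel_mono (fixedι e), fixedMap_ι e he 1 (by rw [MonObj.one_comp, MonObj.comp_one]), MonObj.one_comp,
    MonObj.comp_one]

end FixedMap

/-! ## §4 The Serre tensor construction `A ⊗_𝒪 𝔟 := Fix(E ↷ Aⁿ)` for `𝔟 = E·𝒪ⁿ`, its points, its `𝒪`-action -/

section Serre

variable {A} {O : Type*} [CommRing O] (act : A.RingAction O) [IsCommMonObj A.X] {n : ℕ}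
  (E : Matrix (Fin n) (Fin n) O) (hE : E * E = E)

/-- **SERRE'S TENSOR CONSTRUCTION `A ⊗_𝒪 𝔟`** for the finitely generated projective `𝒪`-module `𝔟 = E·𝒪ⁿ` presented by an
idempotent matrix `E ∈ Mₙ(𝒪)`: the abelian scheme `Fix([E] ↷ Aⁿ)` over `S` (★ `fixed`; a direct factor of `Aⁿ`).
[cite: Conrad2004GrossZagier, §7] [cite: GortzWedhorn2023, Definition 27.89 and Proposition 27.92] -/
def serreTensor : AbelianSchemeOver S :=
  haveI := isMonHom_matrixEnd act E
  fixed (matrixEnd act E) (matrixEnd_idem act hE)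

/-- The inclusion `A ⊗_𝒪 𝔟 ⟶ Aⁿ` (= `ι` of `Fix([E])`). [cite: Kottwitz1992, §5 (p. 390)] -/
def serreι : (serreTensor act E hE).X ⟶ (A.pow n).X :=
  haveI := isMonHom_matrixEnd act E
  fixedι (matrixEnd act E)

/-- The projection `Aⁿ ⟶ A ⊗_𝒪 𝔟` (= `π` of `Fix([E])`, the co-restriction of `[E]`). [cite: Kottwitz1992, §5 (p. 390)] -/
def serreπ : (A.pow n).X ⟶ (serreTensor act E hE).X :=
  haveI := isMonHom_matrixEnd act E
  fixedπ (matrixEnd act E) (matrixEnd_idem act hE)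

/-- `ι` and `π` of `A ⊗_𝒪 𝔟` are homomorphisms; `ι` is a monomorphism. [cite: Kottwitz1992, §5 (p. 390)] -/
theorem isMonHom_serreι_serreπ :
    IsMonHom (serreι act E hE) ∧ IsMonHom (serreπ act E hE) ∧ Mono (serreι act E hE) :=
  haveI := isMonHom_matrixEnd act E
  ⟨isMonHom_fixedι (matrixEnd act E), isMonHom_fixedπ (matrixEnd act E) (matrixEnd_idem act hE),
    mono_fixedι (matrixEnd act E)⟩

/-- `π ≫ ι = [E]` and `ι ≫ π = 𝟙`. [cite: Kottwitz1992, §5 (p. 390)] -/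
theorem serreπ_ι_and_ι_π :
    serreπ act E hE ≫ serreι act E hE = matrixEnd act E ∧ serreι act E hE ≫ serreπ act E hE = 𝟙 _ :=
  haveI := isMonHom_matrixEnd act E
  ⟨fixedπ_comp_ι (matrixEnd act E) (matrixEnd_idem act hE), fixedι_comp_π (matrixEnd act E) (matrixEnd_idem act hE)⟩

/-- `ι ≫ [E] = ι`. [cite: Kottwitz1992, §5 (p. 390)] -/
@[reassoc]
theorem serreι_comp_matrixEnd : serreι act E hE ≫ matrixEnd act E = serreι act E hE :=
  haveI := isMonHom_matrixEnd act E
  fixedι_comp (matrixEnd act E)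

/-- **The points of `A ⊗_𝒪 𝔟`**: `(T ⟶ A ⊗_𝒪 𝔟) ≃ {x ∈ A(T)ⁿ | E · x = x}` (`= A(T) ⊗_𝒪 𝔟` for `𝔟 = E·𝒪ⁿ`), `t ↦ (t ≫ ι ≫ pr_k)_k`.
[cite: Conrad2004GrossZagier, §7] -/
def serreHomEquiv (T : Over S) :
    (T ⟶ (serreTensor act E hE).X) ≃ {x : Fin n → (T ⟶ A.X) // matrixComp act E x = x} where
  toFun t := ⟨powHomEquiv A n T (t ≫ serreι act E hE), by
    rw [← powHomEquiv_comp_matrixEnd, Category.assoc, serreι_comp_matrixEnd]⟩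
  invFun x := powLift x.1 ≫ serreπ act E hE
  left_inv t := by
    change powLift (powHomEquiv A n T (t ≫ serreι act E hE)) ≫ serreπ act E hE = t
    rw [← powHomEquiv_symm_apply, Equiv.symm_apply_apply, Category.assoc, (serreπ_ι_and_ι_π act E hE).2,
      Category.comp_id]
  right_inv x := by
    apply Subtype.ext
    change powHomEquiv A n T ((powLift x.1 ≫ serreπ act E hE) ≫ serreι act E hE) = x.1
    rw [Category.assoc, (serreπ_ι_and_ι_π act E hE).1, powHomEquiv_comp_matrixEnd, ← powHomEquiv_symm_apply,
      Equiv.apply_symm_apply, x.2]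

/-- `serreHomEquiv t = (t ≫ ι ≫ pr_k)_k`. [cite: Kottwitz1992, §5 (p. 390)] -/
@[simp]
theorem serreHomEquiv_apply_coe {T : Over S} (t : T ⟶ (serreTensor act E hE).X) (k : Fin n) :
    (serreHomEquiv act E hE T t : Fin n → (T ⟶ A.X)) k = (t ≫ serreι act E hE) ≫ A.powProj n k := rfl

/-- `serreHomEquiv⁻¹ x = (x_k)_k ≫ π`. [cite: Kottwitz1992, §5 (p. 390)] -/
@[simp]
theorem serreHomEquiv_symm_apply {T : Over S} (x : {x : Fin n → (T ⟶ A.X) // matrixComp act E x = x}) :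
    (serreHomEquiv act E hE T).symm x = powLift x.1 ≫ serreπ act E hE := rfl

/-- `serreHomEquiv` is multiplicative: `(A ⊗_𝒪 𝔟)(T)` is the SUBGROUP `{x | E·x = x}` of `A(T)ⁿ`. [cite: Kottwitz1992, §5 (p. 390)] -/
theorem serreHomEquiv_mul {T : Over S} (t t' : T ⟶ (serreTensor act E hE).X) :
    (serreHomEquiv act E hE T (t * t') : Fin n → (T ⟶ A.X)) =
      (serreHomEquiv act E hE T t : Fin n → (T ⟶ A.X)) * (serreHomEquiv act E hE T t' : Fin n → (T ⟶ A.X)) := by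
  haveI := (isMonHom_serreι_serreπ act E hE).1
  funext k
  simp only [serreHomEquiv_apply_coe, MonObj.mul_comp, ← powHomEquiv_apply, powHomEquiv_mul, Pi.mul_apply]

/-- Naturality of `serreHomEquiv` in `T`: `(s ≫ t) ↦ (s ≫ x_k)_k`. [cite: Kottwitz1992, §5 (p. 390)] -/
theorem serreHomEquiv_comp {T T' : Over S} (s : T' ⟶ T) (t : T ⟶ (serreTensor act E hE).X) (k : Fin n) :
    (serreHomEquiv act E hE T' (s ≫ t) : Fin n → (T' ⟶ A.X)) k = s ≫ (serreHomEquiv act E hE T t : Fin n → (T ⟶ A.X)) k := by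
  simp only [serreHomEquiv_apply_coe, Category.assoc]

/-- `A ⊗_𝒪 𝔟` is commutative. [cite: GortzWedhorn2023, Definition 27.89 and Proposition 27.92] -/
theorem isCommMonObj_serreTensor : IsCommMonObj (serreTensor act E hE).X :=
  haveI := A.isCommMonObj_pow n
  haveI := isMonHom_matrixEnd act E
  isCommMonObj_fixedOver (matrixEnd act E)

/-- The scalar matrices commute with `E`: `[a·1] ≫ [E] = [E] ≫ [a·1]`. [cite: Kottwitz1992, §5 (p. 390)] -/
theorem matrixEnd_scalar_comm (a : O) :
    matrixEnd act (Matrix.scalar (Fin n) a) ≫ matrixEnd act E = matrixEnd act E ≫ matrixEnd act (Matrix.scalar (Fin n) a) := by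
  rw [← matrixEnd_mul, ← matrixEnd_mul, (Matrix.scalar_commute a (fun r' => Commute.all a r') E).eq]

/-- **The induced `𝒪`-action on `A ⊗_𝒪 𝔟`**: `a ↦ [a·1]|_{Fix([E])}` (scalars commute with `E`).
[cite: Conrad2004GrossZagier, §7] [cite: Kottwitz1992, §5 (p. 390)] -/
def serreAction : (serreTensor act E hE).RingAction O :=
  haveI := isMonHom_matrixEnd act E
  { i := fun a => fixedMap (matrixEnd act E) (matrixEnd_idem act hE) (matrixEnd act (Matrix.scalar (Fin n) a))
    isMonHom := fun a => by
      haveI := isMonHom_matrixEnd act (Matrix.scalar (Fin n) a)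
      exact isMonHom_fixedMap (matrixEnd act E) (matrixEnd_idem act hE) _
    i_one := by
      change fixedMap (matrixEnd act E) (matrixEnd_idem act hE) (matrixEnd act (Matrix.scalar (Fin n) 1)) = 𝟙 _
      rw [map_one, matrixEnd_one, fixedMap_id]
    i_mul := fun a b => by
      change fixedMap (matrixEnd act E) (matrixEnd_idem act hE) (matrixEnd act (Matrix.scalar (Fin n) (a * b))) = _
      rw [map_mul, matrixEnd_mul, fixedMap_comp (matrixEnd act E) (matrixEnd_idem act hE) _
        (matrixEnd_scalar_comm act E b) _ (matrixEnd_scalar_comm act E a)]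
      rfl
    i_zero := by
      change fixedMap (matrixEnd act E) (matrixEnd_idem act hE) (matrixEnd act (Matrix.scalar (Fin n) 0)) = 1
      rw [map_zero, matrixEnd_zero, fixedMap_one]
    i_add := fun a b => by
      change fixedMap (matrixEnd act E) (matrixEnd_idem act hE) (matrixEnd act (Matrix.scalar (Fin n) (a + b))) = _
      haveI := A.isCommMonObj_pow n
      rw [map_add, matrixEnd_add, fixedMap_mul (matrixEnd act E) (matrixEnd_idem act hE) _
        (matrixEnd_scalar_comm act E a) _ (matrixEnd_scalar_comm act E b)]
      rfl }

/-- The action on `A ⊗_𝒪 𝔟` is `ι`-compatible with the scalar action on `Aⁿ`: `(a·) ≫ ι = ι ≫ [a·1]`. [cite: Kottwitz1992, §5 (p. 390)] -/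
@[reassoc]
theorem serreAction_i_comp_ι (a : O) :
    (serreAction act E hE).i a ≫ serreι act E hE = serreι act E hE ≫ matrixEnd act (Matrix.scalar (Fin n) a) :=
  haveI := isMonHom_matrixEnd act E
  fixedMap_ι (matrixEnd act E) (matrixEnd_idem act hE) _ (matrixEnd_scalar_comm act E a)

end Serre


end AbelianSchemeOver

end Literature.AlgebraicGeometry.AbelianSchemes

end
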